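import Mathlib
import Literature.Analysis.FluidPDE.SteadyNSClassicalRegularity
import Literature.Analysis.FluidPDE.KNSSTypeIRateLiouvilleMild
import Literature.Analysis.FluidPDE.BoundedMildSmoothRemainder
import Literature.Analysis.FluidPDE.NSBoundedMildSmoothing
import Summits.NavierStokesRegularity.NavierStokesRegularity.Theorems.ThreadingFluxCentreJetDefs
import HarnessLib

/-!
# Crux `PoloidalLiouville` (stmt-NavierStokesRegularity-1222, wall W1), crux idea «steady-centre-sieve» (ns-idea-15 g5,
# `Cruxes/PoloidalLiouville/CentreJetSketch.lean`): the card's literature facts G1 and F2 DISCHARGED from the tree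

Support file (Theorems-side; seat ns-wall-eng-7 g5, cell ns-wall-extremal, W1 adjunct; `--supports
stmt-NavierStokesRegularity-1222 --as helper`).  Two of the three «facts to port» of the card (sketch l.161–181) are ALREADY
consequences of the tree's theory of bounded steady flows on `ℝ³`, and are proved here with the sketch's bodies VERBATIM:

* `CentreJet.steadyClassicalIsMild : <G1 SteadyClassicalIsMild>` — a bounded classical steady Navier–Stokes flow on `ℝ³` is, as a
  constant-in-time field, a bounded ancient mild solution (`ν = 1`).  The gradient-bound hypothesis of G1 is NOT used: the tree's
  Oseen representation of bounded `C²/C¹` steady flows (`IsSteadyNSSolution.eq_heatExtension_sub_oseenDuhamel`, KNSS 2009 Lemma 3.1 +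
  steady drift kill, `SteadyNSClassicalRegularity` / `SteadyNSBoundedMild`) and `isBoundedAncientMildSolution_of_oseen`
  (Lemarié-Rieusset 2016 Thm 6.1) give it outright;
* `CentreJet.steadyNSGradientBounds : <F2 SteadyNSGradientBounds>` — a bounded classical steady flow on `ℝ³` has bounded `∇V`, `∇p`,
  `ΔV`: the constant-in-time field is a restarted bounded mild field (`isKNSSDriftMild_clamp_of_oseenForward`), KNSS 2009 Prop. 4.1
  (tree theorem `KNSS2009_mild_regularity_holds`, constants chosen before the solution) bounds every `‖Dᵏ V‖`, and
  `∇p = ΔV − (V·∇)V`;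
* `CentreJet.analyticOnNhd_of_isSteadyNSOn_univ` — the velocity of a bounded classical steady flow on `ℝ³` is real-analytic
  (`IsSteadyNSSolution.analyticOnNhd_of_bounded`, Lemarié-Rieusset 2016 Thm 9.12 route): the velocity half of F1 in the bounded
  whole-space case (F1 `SteadyNSAnalytic` as typed — interior analyticity of velocity AND pressure on an arbitrary open set — is NOT
  discharged here).

Bridge: `CentreJet.isSteadyNSSolution_of_isSteadyNSOn` (the card's `IsSteadyNSOn univ V p`, `V ∈ C³`, `p ∈ C¹`, is the tree's light
steady class `IsSteadyNSSolution 1 0 V p`, `SteadyNSSolution.lean`).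

HONEST LABEL: consequences of landed Literature theorems about bounded steady flows; the card's conjectures C1/C1*, its target, F1 as
typed, `PoloidalLiouville` (1222) and NS regularity remain OPEN and untouched; information-grade (movement 0).
[cite: KochNadirashviliSereginSverak2009, §3 Lemma 3.1 and §4 Prop. 4.1 (arXiv:0709.3599)] [cite: LemarieRieusset2016, Thm. 6.1 and Thm. 9.12]
-/

-- the summit and its single problem share the name (D-0017 nested layout)
set_option linter.dupNamespace false

noncomputable section

open Set Function Filter MeasureTheory
open scoped RealInnerProductSpace Topology
open Literature.Analysis.FluidPDE

namespace Summit.NavierStokesRegularity.NavierStokesRegularity.Theorems.PoloidalLiouville.CentreJet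

/-! ### Bridge to the tree's light steady class -/

/-- The card's classical steady notion on `ℝ³` is the tree's light steady class `IsSteadyNSSolution 1 0` (`V ∈ C²`, `p ∈ C¹`,
`−ΔV + (V·∇)V + ∇p = 0`, `div V = 0`). -/
theorem isSteadyNSSolution_of_isSteadyNSOn {V : E3 → E3} {p : E3 → ℝ} (h : IsSteadyNSOn univ V p) :
    IsSteadyNSSolution 1 0 V p where
  contDiff_velocity := (contDiffOn_univ.1 h.1).of_le (by norm_num)
  contDiff_pressure := contDiffOn_univ.1 h.2.1
  momentum y := by
    have h4 := h.2.2.2 y (mem_univ y)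
    rw [convect_apply, one_smul, Pi.zero_apply, ← h4]
    abel
  divFree y := h.2.2.1 y (mem_univ y)

/-- The velocity of a bounded classical steady flow on `ℝ³` is real-analytic (tree `IsSteadyNSSolution.analyticOnNhd_of_bounded`:
the flow is Oseen-mild and coincides with the real-analytic local Oseen solution from its own datum). -/
theorem analyticOnNhd_of_isSteadyNSOn_univ {V : E3 → E3} {p : E3 → ℝ} (h : IsSteadyNSOn univ V p)
    (hB : ∃ B : ℝ, ∀ x, ‖V x‖ ≤ B) : AnalyticOnNhd ℝ V univ := by
  obtain ⟨B, hBV⟩ := hB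
  exact (isSteadyNSSolution_of_isSteadyNSOn h).analyticOnNhd_of_bounded hBV

/-- The forward Oseen identity of a bounded classical steady flow, between any two times `s < t`:
`V = e^{(t−s)Δ}V − B¹ₛ(V, V)(t)` for the constant-in-time field. -/
theorem steady_oseen_identity {V : E3 → E3} {p : E3 → ℝ} (h : IsSteadyNSOn univ V p) {B : ℝ} (hBV : ∀ x, ‖V x‖ ≤ B)
    {s t : ℝ} (hst : s < t) (x : E3) :
    V x = Literature.Analysis.UnboundedOperators.heatExtension V (t - s) x - oseenDuhamel 1 s (fun _ : ℝ => V) (fun _ : ℝ => V) t x := by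
  rw [(isSteadyNSSolution_of_isSteadyNSOn h).eq_heatExtension_sub_oseenDuhamel hBV (sub_pos.2 hst) x]
  have h2 := oseenDuhamel_translate 1 0 s (fun _ : ℝ => V) (fun _ : ℝ => V) (t - s) x
  simp only [zero_add, sub_add_cancel] at h2
  rw [h2]

/-! ### G1 discharged -/

/-- ★ **(G1) `SteadyClassicalIsMild`, body verbatim, PROVED**: a bounded classical steady Navier–Stokes flow on `ℝ³` is, as a
constant-in-time field, a bounded ancient mild solution at `ν = 1` (the gradient-bound hypothesis is not needed). -/
theorem steadyClassicalIsMild :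
    ∀ (V : E3 → E3) (p : E3 → ℝ), IsSteadyNSOn univ V p → (∃ B : ℝ, ∀ x, ‖V x‖ ≤ B) →
      (∃ C : ℝ, ∀ x, ‖fderiv ℝ V x‖ ≤ C ∧ ‖gradient p x‖ ≤ C) →
      Literature.Analysis.FluidPDE.IsBoundedAncientMildSolution 1 (fun _ : ℝ => V) := by
  intro V p h hB _
  obtain ⟨B, hBV⟩ := hB
  have hS := isSteadyNSSolution_of_isSteadyNSOn h
  have hVc : Continuous V := hS.contDiff_velocity.continuous
  refine isBoundedAncientMildSolution_of_oseen one_pos ?_ ⟨B, fun _ _ x => hBV x⟩ ?_ ?_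
  · exact (hVc.comp continuous_snd).continuousOn
  · intro t _
    exact VectorCalculus.IsDivFree.isWeaklyDivFree_holds hS.divFree (hS.contDiff_velocity.of_le (by norm_num))
  · intro s t hst _ x
    rw [one_mul]
    exact steady_oseen_identity h hBV hst x

/-! ### F2 discharged -/

/-- Uniform bounds on all derivatives of the velocity of a bounded classical steady flow on `ℝ³` (KNSS 2009 Prop. 4.1 via the
tree theorem `KNSS2009_mild_regularity_holds`, applied to the constant-in-time restarted mild field). -/
theorem exists_iteratedFDeriv_bound_of_isSteadyNSOn_univ {V : E3 → E3} {p : E3 → ℝ} (h : IsSteadyNSOn univ V p)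
    (hB : ∃ B : ℝ, ∀ x, ‖V x‖ ≤ B) : ∃ C : ℕ → ℝ, ∀ k x, ‖iteratedFDeriv ℝ k V x‖ ≤ C k := by
  obtain ⟨B, hBV⟩ := hB
  have hS := isSteadyNSSolution_of_isSteadyNSOn h
  have hVc : Continuous V := hS.contDiff_velocity.continuous
  -- the constant-in-time field on `[0, 2]` is a restarted bounded mild field
  have hdm : IsKNSSDriftMild 2 B (fun (t : ℝ) (x : E3) => V x) 0 := by
    have hcl := isKNSSDriftMild_clamp_of_oseenForward (S := 2) (u := fun (_ : ℝ) (x : E3) => V x) two_pos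
      ((hVc.comp continuous_snd).continuousOn) (K := B) (fun _ _ x => hBV x)
      (fun _ _ => VectorCalculus.IsDivFree.isWeaklyDivFree_holds hS.divFree (hS.contDiff_velocity.of_le (by norm_num)))
      (fun s t _ hst _ x => steady_oseen_identity h hBV hst x)
    exact hcl
  obtain ⟨C, L, hCL⟩ := KNSS2009_mild_regularity_holds B 2 two_pos
  obtain ⟨-, -, hder, -⟩ := hCL hdm
  refine ⟨fun k => C k 1, fun k x => ?_⟩
  exact hder 1 one_pos k (3 / 2) ⟨by norm_num, by norm_num⟩ x

/-- ★ **(F2) `SteadyNSGradientBounds`, body verbatim, PROVED**: a bounded classical steady Navier–Stokes flow on `ℝ³` has globally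
bounded `∇V`, `∇p` and `ΔV` (`‖∇V‖ = ‖D¹V‖`, `‖ΔV‖ ≤ 3‖D²V‖`, `∇p = ΔV − (V·∇)V`). -/
theorem steadyNSGradientBounds :
    ∀ (V : E3 → E3) (p : E3 → ℝ), IsSteadyNSOn univ V p → (∃ B : ℝ, ∀ x, ‖V x‖ ≤ B) →
      ∃ C : ℝ, ∀ x, ‖fderiv ℝ V x‖ ≤ C ∧ ‖gradient p x‖ ≤ C ∧ ‖Laplacian.laplacian V x‖ ≤ C := by
  intro V p h hB
  obtain ⟨C, hC⟩ := exists_iteratedFDeriv_bound_of_isSteadyNSOn_univ h hB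
  obtain ⟨B, hBV⟩ := hB
  have hB0 : 0 ≤ B := (norm_nonneg _).trans (hBV 0)
  have hC1 : ∀ x, ‖fderiv ℝ V x‖ ≤ C 1 := fun x => by
    rw [← norm_iteratedFDeriv_one]; exact hC 1 x
  have hC10 : 0 ≤ C 1 := (norm_nonneg _).trans (hC1 0)
  -- `‖ΔV‖ ≤ 3 ‖D²V‖`
  have hΔ : ∀ x, ‖Laplacian.laplacian V x‖ ≤ 3 * C 2 := fun x => by
    rw [congrFun (InnerProductSpace.laplacian_eq_iteratedFDeriv_orthonormalBasis V (EuclideanSpace.basisFun (Fin 3) ℝ)) x]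
    have hterm : ∀ i : Fin 3, ‖iteratedFDeriv ℝ 2 V x ![(EuclideanSpace.basisFun (Fin 3) ℝ) i,
        (EuclideanSpace.basisFun (Fin 3) ℝ) i]‖ ≤ C 2 := fun i => by
      refine (ContinuousMultilinearMap.le_opNorm _ _).trans ?_
      have hprod : ∏ j : Fin 2, ‖(![(EuclideanSpace.basisFun (Fin 3) ℝ) i, (EuclideanSpace.basisFun (Fin 3) ℝ) i] :
          Fin 2 → E3) j‖ = 1 := by
        simp [Fin.prod_univ_two]
      rw [hprod, mul_one]
      exact hC 2 x
    calc ‖∑ i : Fin 3, iteratedFDeriv ℝ 2 V x ![(EuclideanSpace.basisFun (Fin 3) ℝ) i, (EuclideanSpace.basisFun (Fin 3) ℝ) i]‖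
        ≤ ∑ i : Fin 3, ‖iteratedFDeriv ℝ 2 V x ![(EuclideanSpace.basisFun (Fin 3) ℝ) i, (EuclideanSpace.basisFun (Fin 3) ℝ) i]‖ :=
          norm_sum_le _ _
      _ ≤ ∑ _i : Fin 3, C 2 := Finset.sum_le_sum fun i _ => hterm i
      _ = 3 * C 2 := by simp
  -- `∇p = ΔV − DV V`
  have hp : ∀ x, ‖gradient p x‖ ≤ 3 * C 2 + C 1 * B := fun x => by
    have h4 := h.2.2.2 x (mem_univ x)
    have e : gradient p x = Laplacian.laplacian V x - fderiv ℝ V x (V x) := by rw [← h4]; abel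
    rw [e]
    refine (norm_sub_le _ _).trans (add_le_add (hΔ x) ?_)
    exact (ContinuousLinearMap.le_opNorm _ _).trans (mul_le_mul (hC1 x) (hBV x) (norm_nonneg _) hC10)
  refine ⟨max (C 1) (3 * C 2 + C 1 * B), fun x => ⟨(hC1 x).trans (le_max_left _ _), (hp x).trans (le_max_right _ _), ?_⟩⟩
  exact (hΔ x).trans ((le_add_of_nonneg_right (mul_nonneg hC10 hB0)).trans (le_max_right _ _))

end Summit.NavierStokesRegularity.NavierStokesRegularity.Theorems.PoloidalLiouville.CentreJet

end
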